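import Summits.NavierStokesRegularity.NavierStokesRegularity.Theorems.FilamentSkeletonRssKelvinGateBilinear
import Summits.NavierStokesRegularity.NavierStokesRegularity.Theorems.FilamentSkeletonRssKelvinGateClosingAlgebra

/-!
# Route `FilamentSkeletonRss` · crux `TransverseReductionRJ` (stmt-NavierStokesRegularity-21221) — line `kelvin_gate`,
# stub S3 `NonlinearClosing`: the PICARD ITERATION in the Y-scale (existence of the fixed-point forcing)

Helper file (theorems only, `--supports stmt-NavierStokesRegularity-21221 --as helper`), in the vocabulary of
`FilamentSkeletonRssKelvinGateDefs`.  HONEST FRAMING: bookkeeping for a HYPOTHETICAL filament-type RSS blow-up route;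
nothing here bears on Navier–Stokes regularity; no stub is proved here.

Stub S3 closes the profile equation by the fixed point `W_p = 𝓚_p(−r_p − DW_p[W_p])` of the Kelvin gate (stub S2)
around a dressed base family (stub S1).  Equivalently, in the FORCING variable, `F = Φ F` with
`Φ F := y ↦ −r(y) − D(𝓚_p F)(y)[𝓚_p F(y)]`.  This file proves the existence half, for ANY operator `K` on fields of
`ℝ³` satisfying the two quantitative clauses of `GateSpec` at a fixed parameter — the operator bound
`YBound F R → XBound (K F) (A·R)` and linearity on Y-bounded data — and ANY Y-bounded residual `r`:

* `picard_maps_ball` — `YBound F (2ε) → YBound (Φ F) (2ε)` once `16 A² ε ≤ 1`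
  (`Y(DW[W]) ≤ 2·X(W)²`, file `…KelvinGateBilinear`);
* `picard_contracts` — on that ball `Φ` halves Y-distances: `YBound (F − G) d → YBound (Φ F − Φ G) (d/2)`;
* `picard_exists_fixedPoint` — there is `F` with `YBound F (2ε)` and `F = Φ F` pointwise.  Proof: Picard iterates from
  `0`; pointwise geometric Cauchy estimates in `ℝ³` and in `ℝ³ →L ℝ³` for the fields and their derivatives; the limit is
  `C¹` with the limit derivative (`hasFDerivAt_of_tendstoUniformly`), inherits the weighted bounds, and is fixed because
  `K (F_n) − K (F) = K (F_n − F)` is X-small;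
* `GateSpec.exists_fixedPoint_forcing` / `GateSpec.exists_profileEquation` — instantiation `K := 𝓚 p` for a Kelvin gate.
Left for S3: the static clauses of `AlmostAdmissibleJ` (routine) and the continuity of `p ↦ B_p` (which needs more than
`GateSpec` (3)/(4) as typed — see the sizing note «S3-SIZING-typer-g30.md» attached to the item).
-/

set_option linter.dupNamespace false

noncomputable section

namespace Summit.NavierStokesRegularity.NavierStokesRegularity.Theorems.KelvinGate

open Set Function Filter
open Literature.Analysis.FluidPDE
open scoped InnerProductSpace Laplacian ContDiff Topology

/-! ## Y-scale algebra not in `…KelvinGateTools` -/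

/-- Negation in the Y-scale. -/
theorem YBound.neg {F : EuclideanSpace ℝ (Fin 3) → EuclideanSpace ℝ (Fin 3)} {R : ℝ} (h : YBound F R) :
    YBound (fun y => -F y) R := by
  have h1 := h.smul (-1)
  simp only [neg_smul, one_smul, abs_neg, abs_one, one_mul] at h1
  exact h1

/-- Subtraction in the Y-scale. -/
theorem YBound.sub {F G : EuclideanSpace ℝ (Fin 3) → EuclideanSpace ℝ (Fin 3)} {R S : ℝ} (hF : YBound F R)
    (hG : YBound G S) : YBound (fun y => F y - G y) (R + S) := by
  have h := hF.add hG.neg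
  simp only [← sub_eq_add_neg] at h
  exact h

/-- A Y-bound controls the field and its derivative pointwise WITHOUT the weight. -/
theorem YBound.norm_le' {F : EuclideanSpace ℝ (Fin 3) → EuclideanSpace ℝ (Fin 3)} {R : ℝ} (h : YBound F R)
    (y : EuclideanSpace ℝ (Fin 3)) : ‖F y‖ ≤ R ∧ ‖fderiv ℝ F y‖ ≤ R := by
  have hw : (1:ℝ) ≤ (1 + ‖y‖) ^ 2 := by nlinarith [norm_nonneg y]
  exact ⟨(le_mul_of_one_le_left (norm_nonneg _) hw).trans (h.2 y).1,
    (le_mul_of_one_le_left (norm_nonneg _) hw).trans (h.2 y).2⟩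

/-- An X-bound controls the field and its derivative pointwise WITHOUT the weight. -/
theorem XBound.norm_le' {W : EuclideanSpace ℝ (Fin 3) → EuclideanSpace ℝ (Fin 3)} {R : ℝ} (h : XBound W R)
    (y : EuclideanSpace ℝ (Fin 3)) : ‖W y‖ ≤ R ∧ ‖fderiv ℝ W y‖ ≤ R := by
  have hw : (1:ℝ) ≤ 1 + ‖y‖ := by linarith [norm_nonneg y]
  exact ⟨(le_mul_of_one_le_left (norm_nonneg _) hw).trans (h.2 y).1,
    (le_mul_of_one_le_left (norm_nonneg _) hw).trans (h.2 y).2.1⟩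

/-! ## The Picard map of stub S3 for an abstract gate `K` at a fixed parameter -/

section Picard

variable {K : (EuclideanSpace ℝ (Fin 3) → EuclideanSpace ℝ (Fin 3)) →
    EuclideanSpace ℝ (Fin 3) → EuclideanSpace ℝ (Fin 3)} {A ε : ℝ}
  {r : EuclideanSpace ℝ (Fin 3) → EuclideanSpace ℝ (Fin 3)}

/-- **Linearity in difference form.**  If `K` is linear on Y-bounded data, then for Y-bounded `F, G`:
`K F y = K G y + K (F − G) y`. -/
theorem picard_K_sub
    (hK2 : ∀ (F G : EuclideanSpace ℝ (Fin 3) → EuclideanSpace ℝ (Fin 3)) (s : ℝ), (∃ R, YBound F R) →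
      (∃ R, YBound G R) → K (fun y => F y + s • G y) = fun y => K F y + s • K G y)
    {F G : EuclideanSpace ℝ (Fin 3) → EuclideanSpace ℝ (Fin 3)} {R S : ℝ} (hF : YBound F R) (hG : YBound G S) :
    ∀ y, K F y = K G y + K (fun z => F z - G z) y := by
  have hFG : YBound (fun z => F z - G z) (R + S) := hF.sub hG
  have e : (fun y => G y + (1:ℝ) • (fun z => F z - G z) y) = F := by
    funext y; simp
  have h := hK2 G (fun z => F z - G z) 1 ⟨S, hG⟩ ⟨R + S, hFG⟩
  rw [e] at h
  intro y
  have := congrFun h y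
  simpa using this

/-- **The Picard map preserves the ball `Y ≤ 2ε`.**  With the operator bound `Y(F) ≤ R ⇒ X(K F) ≤ A R` and a residual
`r` with `Y(r) ≤ ε`: if `16 A² ε ≤ 1` then `Y(F) ≤ 2ε ⇒ Y(−r − D(KF)[KF]) ≤ 2ε`
(indeed `≤ ε + 2 (2Aε)² = ε + 8A²ε·ε ≤ ε + ε/2`). -/
theorem picard_maps_ball
    (hK1 : ∀ (F : EuclideanSpace ℝ (Fin 3) → EuclideanSpace ℝ (Fin 3)) (R : ℝ), YBound F R → XBound (K F) (A * R))
    (hr : YBound r ε) (hA : 16 * A ^ 2 * ε ≤ 1)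
    {F : EuclideanSpace ℝ (Fin 3) → EuclideanSpace ℝ (Fin 3)} (hF : YBound F (2 * ε)) :
    YBound (fun y => -r y - fderiv ℝ (K F) y (K F y)) (2 * ε) := by
  have hε : 0 ≤ ε := hr.nonneg
  have hW : XBound (K F) (A * (2 * ε)) := hK1 F _ hF
  have hB : YBound (fun y => fderiv ℝ (K F) y (K F y)) (2 * (A * (2 * ε)) * (A * (2 * ε))) :=
    hW.yBound_fderiv_apply hW
  have h := hr.neg.sub hB
  refine h.mono ?_
  nlinarith [hA, hε, sq_nonneg A]

/-- **Pointwise form of the difference of two Picard images.**  For Y-bounded `F, G` with `H := K (F − G)`: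
`Φ F y − Φ G y = −(D(KG)(y)[H y] + DH(y)[KF y])`. -/
theorem picard_sub_eq
    (hK1 : ∀ (F : EuclideanSpace ℝ (Fin 3) → EuclideanSpace ℝ (Fin 3)) (R : ℝ), YBound F R → XBound (K F) (A * R))
    (hK2 : ∀ (F G : EuclideanSpace ℝ (Fin 3) → EuclideanSpace ℝ (Fin 3)) (s : ℝ), (∃ R, YBound F R) →
      (∃ R, YBound G R) → K (fun y => F y + s • G y) = fun y => K F y + s • K G y)
    {F G : EuclideanSpace ℝ (Fin 3) → EuclideanSpace ℝ (Fin 3)} {R S : ℝ} (hF : YBound F R) (hG : YBound G S)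
    (y : EuclideanSpace ℝ (Fin 3)) :
    (-r y - fderiv ℝ (K F) y (K F y)) - (-r y - fderiv ℝ (K G) y (K G y)) =
      -(fderiv ℝ (K G) y (K (fun z => F z - G z) y) + fderiv ℝ (K (fun z => F z - G z)) y (K F y)) := by
  have hsub := picard_K_sub hK2 hF hG
  have hKG : XBound (K G) (A * S) := hK1 G _ hG
  have hH : XBound (K (fun z => F z - G z)) (A * (R + S)) := hK1 _ _ (hF.sub hG)
  have eKF : K F = fun z => K G z + K (fun z => F z - G z) z := funext hsub
  have hdG : DifferentiableAt ℝ (K G) y := hKG.1.differentiable (by norm_num) y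
  have hdH : DifferentiableAt ℝ (K (fun z => F z - G z)) y := hH.1.differentiable (by norm_num) y
  have eD : fderiv ℝ (K F) y = fderiv ℝ (K G) y + fderiv ℝ (K (fun z => F z - G z)) y := by
    rw [eKF]; exact fderiv_fun_add hdG hdH
  rw [eD, _root_.add_apply, hsub y, map_add]
  abel

/-- **The Picard map halves Y-distances on the ball `Y ≤ 2ε`** (when `16 A² ε ≤ 1`):
`Y(F), Y(G) ≤ 2ε`, `Y(F − G) ≤ d` ⇒ `Y(Φ F − Φ G) ≤ d/2` (indeed `≤ 2(2Aε)(Ad) + 2(Ad)(2Aε) = 8A²ε·d`). -/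
theorem picard_contracts
    (hK1 : ∀ (F : EuclideanSpace ℝ (Fin 3) → EuclideanSpace ℝ (Fin 3)) (R : ℝ), YBound F R → XBound (K F) (A * R))
    (hK2 : ∀ (F G : EuclideanSpace ℝ (Fin 3) → EuclideanSpace ℝ (Fin 3)) (s : ℝ), (∃ R, YBound F R) →
      (∃ R, YBound G R) → K (fun y => F y + s • G y) = fun y => K F y + s • K G y)
    (hr : YBound r ε) (hA : 16 * A ^ 2 * ε ≤ 1)
    {F G : EuclideanSpace ℝ (Fin 3) → EuclideanSpace ℝ (Fin 3)} (hF : YBound F (2 * ε)) (hG : YBound G (2 * ε))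
    {d : ℝ} (hFG : YBound (fun y => F y - G y) d) :
    YBound (fun y => (-r y - fderiv ℝ (K F) y (K F y)) - (-r y - fderiv ℝ (K G) y (K G y))) (d / 2) := by
  have hε : 0 ≤ ε := hr.nonneg
  have hd : 0 ≤ d := hFG.nonneg
  have hKF : XBound (K F) (A * (2 * ε)) := hK1 F _ hF
  have hKG : XBound (K G) (A * (2 * ε)) := hK1 G _ hG
  have hH : XBound (K (fun z => F z - G z)) (A * d) := hK1 _ _ hFG
  have h1 : YBound (fun y => fderiv ℝ (K G) y (K (fun z => F z - G z) y)) (2 * (A * (2 * ε)) * (A * d)) :=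
    hKG.yBound_fderiv_apply hH
  have h2 : YBound (fun y => fderiv ℝ (K (fun z => F z - G z)) y (K F y)) (2 * (A * d) * (A * (2 * ε))) :=
    hH.yBound_fderiv_apply hKF
  have h := (h1.add h2).neg
  have e : (fun y => (-r y - fderiv ℝ (K F) y (K F y)) - (-r y - fderiv ℝ (K G) y (K G y))) =
      fun y => -(fderiv ℝ (K G) y (K (fun z => F z - G z) y) + fderiv ℝ (K (fun z => F z - G z)) y (K F y)) :=
    funext (picard_sub_eq hK1 hK2 hF hG)
  rw [e]
  refine h.mono ?_
  have hA0 : 0 ≤ A ^ 2 * ε := by positivity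
  nlinarith [hA, hε, hd, sq_nonneg A, mul_nonneg hA0 hd]

/-- **The Picard iterates** `F₀ = 0`, `F_{n+1} = Φ F_n` stay in the ball `Y ≤ 2ε` and have geometrically decreasing
increments `Y(F_{n+1} − F_n) ≤ 2ε / 2^n`.  (Stated for any sequence satisfying the recursion.) -/
theorem picard_seq_bounds
    (hK1 : ∀ (F : EuclideanSpace ℝ (Fin 3) → EuclideanSpace ℝ (Fin 3)) (R : ℝ), YBound F R → XBound (K F) (A * R))
    (hK2 : ∀ (F G : EuclideanSpace ℝ (Fin 3) → EuclideanSpace ℝ (Fin 3)) (s : ℝ), (∃ R, YBound F R) →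
      (∃ R, YBound G R) → K (fun y => F y + s • G y) = fun y => K F y + s • K G y)
    (hr : YBound r ε) (hA : 16 * A ^ 2 * ε ≤ 1)
    {Fs : ℕ → EuclideanSpace ℝ (Fin 3) → EuclideanSpace ℝ (Fin 3)} (h0 : Fs 0 = fun _ => 0)
    (hsucc : ∀ n, Fs (n + 1) = fun y => -r y - fderiv ℝ (K (Fs n)) y (K (Fs n) y)) (n : ℕ) :
    YBound (Fs n) (2 * ε) ∧ YBound (fun y => Fs (n + 1) y - Fs n y) (2 * ε / 2 ^ n) := by
  have hε : 0 ≤ ε := hr.nonneg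
  induction n with
  | zero =>
    have hz : YBound (fun _ : EuclideanSpace ℝ (Fin 3) => (0 : EuclideanSpace ℝ (Fin 3))) (2 * ε) :=
      yBound_zero.mono (by linarith)
    rw [h0]
    refine ⟨hz, ?_⟩
    have h1 := picard_maps_ball hK1 hr hA hz
    rw [hsucc 0, h0]
    simpa using h1
  | succ n ih =>
    obtain ⟨hn, hdn⟩ := ih
    have hn1 : YBound (Fs (n + 1)) (2 * ε) := by
      rw [hsucc n]
      exact picard_maps_ball hK1 hr hA hn
    refine ⟨hn1, ?_⟩
    have h := picard_contracts hK1 hK2 hr hA hn1 hn hdn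
    have e : (fun y => Fs (n + 1 + 1) y - Fs (n + 1) y) =
        fun y => (-r y - fderiv ℝ (K (Fs (n + 1))) y (K (Fs (n + 1)) y)) -
          (-r y - fderiv ℝ (K (Fs n)) y (K (Fs n) y)) := by
      funext y
      have e1 := congrFun (hsucc (n + 1)) y
      have e2 := congrFun (hsucc n) y
      rw [e1, e2]
    rw [e]
    refine h.mono (le_of_eq ?_)
    rw [pow_succ]
    ring

/-- **Existence of the fixed-point forcing (Picard).**  Under the operator bound `Y(F) ≤ R ⇒ X(K F) ≤ A R`, linearity of
`K` on Y-bounded data, a residual with `Y(r) ≤ ε` and the smallness `16 A² ε ≤ 1`, there is a forcing `F` with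
`Y(F) ≤ 2ε` and `F(y) = −r(y) − D(K F)(y)[K F(y)]` for every `y`. -/
theorem picard_exists_fixedPoint
    (hK1 : ∀ (F : EuclideanSpace ℝ (Fin 3) → EuclideanSpace ℝ (Fin 3)) (R : ℝ), YBound F R → XBound (K F) (A * R))
    (hK2 : ∀ (F G : EuclideanSpace ℝ (Fin 3) → EuclideanSpace ℝ (Fin 3)) (s : ℝ), (∃ R, YBound F R) →
      (∃ R, YBound G R) → K (fun y => F y + s • G y) = fun y => K F y + s • K G y)
    (hr : YBound r ε) (hA : 16 * A ^ 2 * ε ≤ 1) :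
    ∃ F : EuclideanSpace ℝ (Fin 3) → EuclideanSpace ℝ (Fin 3),
      YBound F (2 * ε) ∧ ∀ y, F y = -r y - fderiv ℝ (K F) y (K F y) := by
  have hε : 0 ≤ ε := hr.nonneg
  -- the Picard sequence
  obtain ⟨Fs, h0, hsucc⟩ : ∃ Fs : ℕ → EuclideanSpace ℝ (Fin 3) → EuclideanSpace ℝ (Fin 3), (Fs 0 = fun _ => 0) ∧
      ∀ n, Fs (n + 1) = fun y => -r y - fderiv ℝ (K (Fs n)) y (K (Fs n) y) :=
    ⟨fun n => (fun F => fun y => -r y - fderiv ℝ (K F) y (K F y))^[n] (fun _ => 0), rfl,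
      fun n => Function.iterate_succ_apply' _ n _⟩
  have hb := fun n => picard_seq_bounds hK1 hK2 hr hA h0 hsucc n
  have hC1s : ∀ n, ContDiff ℝ 1 (Fs n) := fun n => (hb n).1.1
  have hdiff : ∀ n y, DifferentiableAt ℝ (Fs n) y := fun n y => (hC1s n).differentiable (by norm_num) y
  have h2n : ∀ n : ℕ, (2:ℝ) * ε / 2 ^ n = 2 * ε * (1 / 2) ^ n := fun n => by
    rw [one_div, inv_pow, div_eq_mul_inv]
  -- weighted geometric increments, for the fields and for their derivatives
  have hdist : ∀ y n, dist (Fs n y) (Fs (n + 1) y) ≤ 2 * ε / (1 + ‖y‖) ^ 2 * (1 / 2) ^ n := by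
    intro y n
    rw [dist_comm, dist_eq_norm]
    have h := (hb n).2.norm_le y
    rw [h2n] at h
    calc ‖Fs (n + 1) y - Fs n y‖ ≤ 2 * ε * (1 / 2) ^ n / (1 + ‖y‖) ^ 2 := h
      _ = 2 * ε / (1 + ‖y‖) ^ 2 * (1 / 2) ^ n := by ring
  have hdistD : ∀ y n, dist (fderiv ℝ (Fs n) y) (fderiv ℝ (Fs (n + 1)) y) ≤
      2 * ε / (1 + ‖y‖) ^ 2 * (1 / 2) ^ n := by
    intro y n
    rw [dist_comm, dist_eq_norm]
    have h := ((hb n).2.2 y).2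
    rw [fderiv_fun_sub (hdiff (n + 1) y) (hdiff n y), h2n] at h
    have e : 2 * ε / (1 + ‖y‖) ^ 2 * (1 / 2 : ℝ) ^ n = 2 * ε * (1 / 2) ^ n / (1 + ‖y‖) ^ 2 := by ring
    rw [e, le_div_iff₀ (by positivity)]
    calc ‖fderiv ℝ (Fs (n + 1)) y - fderiv ℝ (Fs n) y‖ * (1 + ‖y‖) ^ 2
        = (1 + ‖y‖) ^ 2 * ‖fderiv ℝ (Fs (n + 1)) y - fderiv ℝ (Fs n) y‖ := by ring
      _ ≤ 2 * ε * (1 / 2) ^ n := h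
  -- pointwise limits (values in `ℝ³`, derivatives in `ℝ³ →L ℝ³`; both complete)
  have hlimF : ∀ y, ∃ v, Tendsto (fun n => Fs n y) atTop (𝓝 v) := fun y =>
    cauchySeq_tendsto_of_complete (cauchySeq_of_le_geometric (1 / 2) _ (by norm_num) (hdist y))
  have hlimD : ∀ y, ∃ L, Tendsto (fun n => fderiv ℝ (Fs n) y) atTop (𝓝 L) := fun y =>
    cauchySeq_tendsto_of_complete (cauchySeq_of_le_geometric (1 / 2) _ (by norm_num) (hdistD y))
  choose Flim hFlim using hlimF
  choose Glim hGlim using hlimD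
  -- geometric tails
  have htail : ∀ y n, dist (Fs n y) (Flim y) ≤ 4 * ε / (1 + ‖y‖) ^ 2 * (1 / 2) ^ n := by
    intro y n
    have h := dist_le_of_le_geometric_of_tendsto (1 / 2) _ (by norm_num) (hdist y) (hFlim y) n
    calc dist (Fs n y) (Flim y) ≤ 2 * ε / (1 + ‖y‖) ^ 2 * (1 / 2) ^ n / (1 - 1 / 2) := h
      _ = 4 * ε / (1 + ‖y‖) ^ 2 * (1 / 2) ^ n := by ring
  have htailD : ∀ y n, dist (fderiv ℝ (Fs n) y) (Glim y) ≤ 4 * ε / (1 + ‖y‖) ^ 2 * (1 / 2) ^ n := by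
    intro y n
    have h := dist_le_of_le_geometric_of_tendsto (1 / 2) _ (by norm_num) (hdistD y) (hGlim y) n
    calc dist (fderiv ℝ (Fs n) y) (Glim y) ≤ 2 * ε / (1 + ‖y‖) ^ 2 * (1 / 2) ^ n / (1 - 1 / 2) := h
      _ = 4 * ε / (1 + ‖y‖) ^ 2 * (1 / 2) ^ n := by ring
  -- the derivatives converge uniformly (the weight is `≥ 1`)
  have hpow0 : Tendsto (fun n : ℕ => 4 * ε * (1 / 2 : ℝ) ^ n) atTop (𝓝 0) := by
    have h := (tendsto_pow_atTop_nhds_zero_of_lt_one (by norm_num : (0:ℝ) ≤ 1 / 2)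
      (by norm_num : (1 / 2 : ℝ) < 1)).const_mul (4 * ε)
    rwa [mul_zero] at h
  have hunif : TendstoUniformly (fun n y => fderiv ℝ (Fs n) y) Glim atTop := by
    rw [Metric.tendstoUniformly_iff]
    intro δ hδ
    filter_upwards [(hpow0.eventually (gt_mem_nhds hδ))] with n hn y
    rw [dist_comm]
    have hw : (1:ℝ) ≤ (1 + ‖y‖) ^ 2 := by nlinarith [norm_nonneg y]
    calc dist (fderiv ℝ (Fs n) y) (Glim y) ≤ 4 * ε / (1 + ‖y‖) ^ 2 * (1 / 2) ^ n := htailD y n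
      _ ≤ 4 * ε / 1 * (1 / 2) ^ n := by
          gcongr
      _ = 4 * ε * (1 / 2) ^ n := by ring
      _ < δ := hn
  -- the limit is `C¹` with derivative `Glim`
  have hderiv : ∀ y, HasFDerivAt Flim (Glim y) y :=
    hasFDerivAt_of_tendstoUniformly hunif (fun n y => (hdiff n y).hasFDerivAt) hFlim
  have hfd : fderiv ℝ Flim = Glim := funext fun y => (hderiv y).fderiv
  have hC1 : ContDiff ℝ 1 Flim := by
    rw [contDiff_one_iff_fderiv]
    refine ⟨fun y => (hderiv y).differentiableAt, ?_⟩
    rw [hfd]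
    exact hunif.continuous (Eventually.of_forall fun n => (hC1s n).continuous_fderiv one_ne_zero).frequently
  -- weighted bounds pass to the limit: `Y(Flim) ≤ 2ε` and `Y(Fs n − Flim) ≤ 4ε (1/2)^n`
  have hYlim : YBound Flim (2 * ε) := by
    refine ⟨hC1, fun y => ⟨?_, ?_⟩⟩
    · refine le_of_tendsto ((hFlim y).norm.const_mul ((1 + ‖y‖) ^ 2)) (Eventually.of_forall fun n => ?_)
      exact ((hb n).1.2 y).1
    · rw [hfd]
      refine le_of_tendsto ((hGlim y).norm.const_mul ((1 + ‖y‖) ^ 2)) (Eventually.of_forall fun n => ?_)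
      exact ((hb n).1.2 y).2
  have hYdiff : ∀ n, YBound (fun y => Fs n y - Flim y) (4 * ε * (1 / 2) ^ n) := by
    intro n
    refine ⟨(hC1s n).sub hC1, fun y => ⟨?_, ?_⟩⟩
    · calc (1 + ‖y‖) ^ 2 * ‖Fs n y - Flim y‖ = dist (Fs n y) (Flim y) * (1 + ‖y‖) ^ 2 := by
            rw [dist_eq_norm]; ring
        _ ≤ 4 * ε / (1 + ‖y‖) ^ 2 * (1 / 2) ^ n * (1 + ‖y‖) ^ 2 :=
            mul_le_mul_of_nonneg_right (htail y n) (by positivity)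
        _ = 4 * ε * (1 / 2) ^ n := by field_simp
    · rw [fderiv_fun_sub (hdiff n y) ((hderiv y).differentiableAt), hfd]
      calc (1 + ‖y‖) ^ 2 * ‖fderiv ℝ (Fs n) y - Glim y‖ = dist (fderiv ℝ (Fs n) y) (Glim y) * (1 + ‖y‖) ^ 2 := by
            rw [dist_eq_norm]; ring
        _ ≤ 4 * ε / (1 + ‖y‖) ^ 2 * (1 / 2) ^ n * (1 + ‖y‖) ^ 2 :=
            mul_le_mul_of_nonneg_right (htailD y n) (by positivity)
        _ = 4 * ε * (1 / 2) ^ n := by field_simp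
  -- the fixed-point identity: pass to the limit in `F_{n+1} = Φ F_n`
  refine ⟨Flim, hYlim, fun y => ?_⟩
  have hKlim : XBound (K Flim) (A * (2 * ε)) := hK1 _ _ hYlim
  have hA0 : 0 ≤ A := by
    have h := (hK1 _ _ (yBound_zero.mono (zero_le_one))).nonneg
    linarith
  -- `K (Fs n) = K Flim + H n` with `H n := K (Fs n − Flim)` X-small
  have hH : ∀ n, XBound (K (fun z => Fs n z - Flim z)) (A * (4 * ε * (1 / 2) ^ n)) := fun n => hK1 _ _ (hYdiff n)
  have hsplit : ∀ n, K (Fs n) y = K Flim y + K (fun z => Fs n z - Flim z) y := fun n =>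
    picard_K_sub hK2 (hb n).1 hYlim y
  have hsplitD : ∀ n, fderiv ℝ (K (Fs n)) y = fderiv ℝ (K Flim) y + fderiv ℝ (K (fun z => Fs n z - Flim z)) y := by
    intro n
    have e : K (Fs n) = fun z => K Flim z + K (fun z => Fs n z - Flim z) z :=
      funext (picard_K_sub hK2 (hb n).1 hYlim)
    rw [e]
    exact fderiv_fun_add (hKlim.1.differentiable (by norm_num) y) ((hH n).1.differentiable (by norm_num) y)
  have hApow : Tendsto (fun n : ℕ => A * (4 * ε * (1 / 2 : ℝ) ^ n)) atTop (𝓝 0) := by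
    have h := hpow0.const_mul A
    rwa [mul_zero] at h
  have hHv : Tendsto (fun n => K (fun z => Fs n z - Flim z) y) atTop (𝓝 0) := by
    rw [tendsto_zero_iff_norm_tendsto_zero]
    exact squeeze_zero (fun n => norm_nonneg _) (fun n => ((hH n).norm_le' y).1) hApow
  have hHD : Tendsto (fun n => fderiv ℝ (K (fun z => Fs n z - Flim z)) y) atTop (𝓝 0) := by
    rw [tendsto_zero_iff_norm_tendsto_zero]
    exact squeeze_zero (fun n => norm_nonneg _) (fun n => ((hH n).norm_le' y).2) hApow
  have hv : Tendsto (fun n => K (Fs n) y) atTop (𝓝 (K Flim y)) := by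
    have h := (tendsto_const_nhds (x := K Flim y)).add hHv
    rw [add_zero] at h
    exact h.congr fun n => (hsplit n).symm
  have hL : Tendsto (fun n => fderiv ℝ (K (Fs n)) y) atTop (𝓝 (fderiv ℝ (K Flim) y)) := by
    have h := (tendsto_const_nhds (x := fderiv ℝ (K Flim) y)).add hHD
    rw [add_zero] at h
    exact h.congr fun n => (hsplitD n).symm
  have happ : Tendsto (fun n => fderiv ℝ (K (Fs n)) y (K (Fs n) y)) atTop (𝓝 (fderiv ℝ (K Flim) y (K Flim y))) := by
    have hc : Continuous fun q : (EuclideanSpace ℝ (Fin 3) →L[ℝ] EuclideanSpace ℝ (Fin 3)) × EuclideanSpace ℝ (Fin 3) =>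
        q.1 q.2 := isBoundedBilinearMap_apply.continuous
    exact (hc.tendsto (fderiv ℝ (K Flim) y, K Flim y)).comp (hL.prodMk_nhds hv)
  have hrhs : Tendsto (fun n => -r y - fderiv ℝ (K (Fs n)) y (K (Fs n) y)) atTop
      (𝓝 (-r y - fderiv ℝ (K Flim) y (K Flim y))) := tendsto_const_nhds.sub happ
  have hlhs : Tendsto (fun n => Fs (n + 1) y) atTop (𝓝 (Flim y)) := (hFlim y).comp (tendsto_add_atTop_nat 1)
  have heq : (fun n => Fs (n + 1) y) = fun n => -r y - fderiv ℝ (K (Fs n)) y (K (Fs n) y) :=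
    funext fun n => congrFun (hsucc n) y
  rw [heq] at hlhs
  exact tendsto_nhds_unique hlhs hrhs

end Picard

/-! ## Instantiation for a Kelvin gate (`GateSpec`, stub S2) at a parameter in the cube -/

/-- **Fixed-point forcing for a Kelvin gate.**  If `(𝓚, 𝓠, 𝓑)` satisfies `GateSpec N Γ κ C₂ …`, `p` lies in the cube,
`r` is a Y-bounded residual with `Y(r) ≤ ε` and `16 (C₂ Γ^κ)² ε ≤ 1`, then there is a forcing `F` with `Y(F) ≤ 2ε` and
`F = −r − D(𝓚_p F)[𝓚_p F]` pointwise (clauses (1) operator bound and (2) linearity of `GateSpec` are all that is used). -/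
theorem GateSpec.exists_fixedPoint_forcing {N : ℕ} {Γ κ C₂ : ℝ} {α : (Fin N → ℝ) → ℝ}
    {D : (Fin N → ℝ) → Fin N → EuclideanSpace ℝ (Fin 3) → EuclideanSpace ℝ (Fin 3)}
    {U0 : (Fin N → ℝ) → EuclideanSpace ℝ (Fin 3) → EuclideanSpace ℝ (Fin 3)}
    {𝓚 : (Fin N → ℝ) → (EuclideanSpace ℝ (Fin 3) → EuclideanSpace ℝ (Fin 3)) → EuclideanSpace ℝ (Fin 3) → EuclideanSpace ℝ (Fin 3)}
    {𝓠 : (Fin N → ℝ) → (EuclideanSpace ℝ (Fin 3) → EuclideanSpace ℝ (Fin 3)) → EuclideanSpace ℝ (Fin 3) → ℝ}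
    {𝓑 : (Fin N → ℝ) → (EuclideanSpace ℝ (Fin 3) → EuclideanSpace ℝ (Fin 3)) → Fin N → ℝ}
    (hgate : GateSpec N Γ κ C₂ α D U0 𝓚 𝓠 𝓑) {p : Fin N → ℝ} (hp : ∀ i, p i ∈ Icc (0:ℝ) 1)
    {r : EuclideanSpace ℝ (Fin 3) → EuclideanSpace ℝ (Fin 3)} {ε : ℝ} (hr : YBound r ε)
    (hA : 16 * (C₂ * Γ ^ κ) ^ 2 * ε ≤ 1) :
    ∃ F : EuclideanSpace ℝ (Fin 3) → EuclideanSpace ℝ (Fin 3),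
      YBound F (2 * ε) ∧ ∀ y, F y = -r y - fderiv ℝ (𝓚 p F) y (𝓚 p F y) :=
  picard_exists_fixedPoint (K := 𝓚 p) (A := C₂ * Γ ^ κ) (fun F R hF => ((hgate p hp).1 F R hF).1)
    (fun F G s hF hG => ((hgate p hp).2.1 F G s hF hG).1) hr hA

/-- **Stub S3, existence half, packaged.**  Around a base triple `(U⁰_p, P⁰_p, b⁰_p)` with `U⁰_p ∈ C²`, `P⁰_p`
differentiable and residual `r_p = baseRes α D U⁰ P⁰ b⁰ p` of Y-size `≤ ε`, a Kelvin gate with `16 (C₂ Γ^κ)² ε ≤ 1`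
produces a forcing `F` with `Y(F) ≤ 2ε` such that `U_p := U⁰_p + 𝓚_p F`, `P_p := P⁰_p + 𝓠_p F`,
`B_p := b⁰_p + 𝓑_p F` satisfy the crux's profile equation VERBATIM at every point (the equation clause of
`AlmostAdmissibleJ`; composition of the Picard fixed point with `GateSpec.profileEquation_of_fixedPoint`). -/
theorem GateSpec.exists_profileEquation {N : ℕ} {Γ κ C₂ : ℝ} {α : (Fin N → ℝ) → ℝ}
    {D : (Fin N → ℝ) → Fin N → EuclideanSpace ℝ (Fin 3) → EuclideanSpace ℝ (Fin 3)}
    {U0 : (Fin N → ℝ) → EuclideanSpace ℝ (Fin 3) → EuclideanSpace ℝ (Fin 3)}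
    {P0 : (Fin N → ℝ) → EuclideanSpace ℝ (Fin 3) → ℝ} {b0 : (Fin N → ℝ) → Fin N → ℝ}
    {𝓚 : (Fin N → ℝ) → (EuclideanSpace ℝ (Fin 3) → EuclideanSpace ℝ (Fin 3)) → EuclideanSpace ℝ (Fin 3) → EuclideanSpace ℝ (Fin 3)}
    {𝓠 : (Fin N → ℝ) → (EuclideanSpace ℝ (Fin 3) → EuclideanSpace ℝ (Fin 3)) → EuclideanSpace ℝ (Fin 3) → ℝ}
    {𝓑 : (Fin N → ℝ) → (EuclideanSpace ℝ (Fin 3) → EuclideanSpace ℝ (Fin 3)) → Fin N → ℝ}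
    (hgate : GateSpec N Γ κ C₂ α D U0 𝓚 𝓠 𝓑) {p : Fin N → ℝ} (hp : ∀ i, p i ∈ Icc (0:ℝ) 1)
    (hU : ContDiff ℝ 2 (U0 p)) (hP : Differentiable ℝ (P0 p)) {ε : ℝ}
    (hr : YBound (baseRes α D U0 P0 b0 p) ε) (hA : 16 * (C₂ * Γ ^ κ) ^ 2 * ε ≤ 1) :
    ∃ F : EuclideanSpace ℝ (Fin 3) → EuclideanSpace ℝ (Fin 3), YBound F (2 * ε) ∧
      (∀ y, F y = -(baseRes α D U0 P0 b0 p y) - fderiv ℝ (𝓚 p F) y (𝓚 p F y)) ∧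
      ∀ y, α p • (cross (EuclideanSpace.single 2 1) ((fun z => U0 p z + 𝓚 p F z) y) -
            fderiv ℝ (fun z => U0 p z + 𝓚 p F z) y (cross (EuclideanSpace.single 2 1) y)) +
          (1/2:ℝ) • (fun z => U0 p z + 𝓚 p F z) y + (1/2:ℝ) • fderiv ℝ (fun z => U0 p z + 𝓚 p F z) y y -
          (Laplacian.laplacian (fun z => U0 p z + 𝓚 p F z)) y +
          fderiv ℝ (fun z => U0 p z + 𝓚 p F z) y ((fun z => U0 p z + 𝓚 p F z) y) +
          gradient (fun z => P0 p z + 𝓠 p F z) y = ∑ j, (b0 p j + 𝓑 p F j) • D p j y := by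
  obtain ⟨F, hF, hfix⟩ := hgate.exists_fixedPoint_forcing hp hr hA
  exact ⟨F, hF, hfix, hgate.profileEquation_of_fixedPoint hp hU hP hF hfix⟩

end Summit.NavierStokesRegularity.NavierStokesRegularity.Theorems.KelvinGate
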